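import Mathlib
import Literature.Combinatorics.Additive.TripleProductProperty
import Summits.MatrixMultiplication.MatrixMultiplication.Theorems.SnSubsetDichotomyThresholdSubsetTriplesPairFactorisation

/-!
# `SnSubsetDichotomy.ThresholdSubsetTriples`, line `interleaved-subsignature-ascent` — stub `stub_ownerPairNoThird`

Registered stub `stub_ownerPairNoThird` of crux `stmt-MatrixMultiplication-10882` (census c3a §3 of the line
`interleaved-subsignature-ascent`): an exactly factorising owner pair of chain classes
`S_A = subsig (ownerSystem L)`, `S_B = subsig (ownerSystem Lᶜ)` leaves NO room for a third class — if
`(S_A, S_B, U)` has the triple product property then `|U| ≤ 1`.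

Proof (elementary, explicit): both owner classes are ROOTED (`1 ∈ S_A`, `1 ∈ S_B`: every level of an owner
system carries its identity letter `swap k k = 1`, `one_mem_subsig_ownerSystem`).  Given `u, u' ∈ U`, the landed
exact pair factorisation `stub_pairFactorisation` writes `(u u'⁻¹)⁻¹ = a⁻¹ b` with `a ∈ S_A`, `b ∈ S_B`; then the
TPP relation `1·a⁻¹ · (b·1⁻¹) · (u u'⁻¹) = 1` with `s = 1, s' = a, t = b, t' = 1` forces `u = u'`
(third conjunct of the triple product property).  So any two elements of `U` coincide (`Finset.card_le_one`).
Mathlib + the tree's `TripleProductProperty` + the landed `…PairFactorisation` / `…ChainDefs` vocabulary only.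
-/

-- `Summit.<Summit>.<Problem>` is the tree's mandated summit-side namespace; for this single-conjunct summit the
-- two components coincide, so the file silences `dupNamespace` (same as the vocabulary file it imports).
set_option linter.dupNamespace false
set_option autoImplicit false

namespace Summit.MatrixMultiplication.MatrixMultiplication.Theorems.ThresholdSubsetTriples

open scoped Pointwise
open Literature.Combinatorics.Additive

variable {n : ℕ}

/-- A chain class whose every level carries the identity letter (`k ∈ D k`, i.e. `swap k k = 1 ∈ P_k`) is
rooted at every stage: `1 ∈ subsigBelow D m` for all `m`. -/
private theorem one_mem_subsigBelow_of_self_mem (D : Fin n → Finset (Fin n)) (hD : ∀ k : Fin n, k ∈ D k) :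
    ∀ m : ℕ, (1 : Equiv.Perm (Fin n)) ∈ subsigBelow D m := by
  intro m
  induction m with
  | zero => rw [subsigBelow_zero]; exact Finset.mem_singleton_self _
  | succ m ih =>
    rw [subsigBelow_succ]
    have h1 : (1 : Equiv.Perm (Fin n)) ∈
        (if h : m < n then starPiece (D ⟨m, h⟩) ⟨m, h⟩ else ({1} : Finset (Equiv.Perm (Fin n)))) := by
      by_cases h : m < n
      · rw [dif_pos h]
        exact mem_starPiece.2 ⟨⟨m, h⟩, hD _, Equiv.swap_self _⟩
      · rw [dif_neg h]
        exact Finset.mem_singleton_self _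
    simpa using Finset.mul_mem_mul h1 ih

/-- Every level of an owner system carries its identity letter: `k ∈ ownerSystem L k`. -/
private theorem self_mem_ownerSystem (L : Finset (Fin n)) (k : Fin n) : k ∈ ownerSystem L k := by
  by_cases hk : k ∈ L
  · rw [ownerSystem_of_mem hk, Finset.mem_filter]
    exact ⟨Finset.mem_univ _, le_rfl⟩
  · rw [ownerSystem_of_not_mem hk]
    exact Finset.mem_singleton_self _

/-- Owner chain classes are rooted: `1 ∈ subsig (ownerSystem L)`. -/
private theorem one_mem_subsig_ownerSystem (L : Finset (Fin n)) :
    (1 : Equiv.Perm (Fin n)) ∈ subsig (ownerSystem L) :=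
  one_mem_subsigBelow_of_self_mem _ (self_mem_ownerSystem L) n

/-- **Stub `stub_ownerPairNoThird` (census c3a §3: exact pairs leave no room for a third class).**  If the two
owner chain classes `subsig (ownerSystem L)`, `subsig (ownerSystem Lᶜ)` and a set `U ⊆ S_n` satisfy the triple
product property, then `|U| ≤ 1`: for `u, u' ∈ U` factor `(u u'⁻¹)⁻¹ = a⁻¹ b` in the owner pair
(`stub_pairFactorisation`) and feed `s = 1, s' = a, t = b, t' = 1` (both classes contain `1`) into the TPP
relation, whose third conclusion is `u = u'`. [elementary; census c3a of crux stmt-MatrixMultiplication-10882] -/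
theorem stub_ownerPairNoThird {n : ℕ} (L : Finset (Fin n)) (U : Finset (Equiv.Perm (Fin n)))
    (hT : TripleProductProperty (subsig (ownerSystem L)) (subsig (ownerSystem Lᶜ)) U) : U.card ≤ 1 := by
  rw [Finset.card_le_one]
  intro u hu u' hu'
  obtain ⟨⟨a, b⟩, ⟨ha, hb, hab⟩, -⟩ := stub_pairFactorisation L (u * u'⁻¹)⁻¹
  have hrel : (1 : Equiv.Perm (Fin n)) * a⁻¹ * (b * 1⁻¹) * (u * u'⁻¹) = 1 := by
    rw [one_mul, inv_one, mul_one, hab, inv_mul_cancel]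
  exact (hT 1 (one_mem_subsig_ownerSystem L) a ha b hb 1 (one_mem_subsig_ownerSystem Lᶜ) u hu u' hu' hrel).2.2

end Summit.MatrixMultiplication.MatrixMultiplication.Theorems.ThresholdSubsetTriples
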